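import Literature.NumberTheory.NumberFields.NFIsoNormPoly
import Literature.NumberTheory.NumberFields.NFIsoDegreeTest
import Literature.NumberTheory.NumberFields.NFIsoLocalFactorsCap
import Literature.Computability.Complexity.IrreducibilityLLLDecide
import Literature.Computability.Complexity.NumberFieldIsomorphismProofs
import Mathlib.FieldTheory.Perfect
import HarnessLib

/-!
# The polynomial-time isomorphism test for number fields, and its correctness (Landau 1985)

Support file for the discharge of the named fact
`Literature.NumberTheory.NumberFields.nfIso_mem_P` (number-field isomorphism is in `P`;
Landau 1985, Thm. 2.1 and Cor.; A. K. Lenstra 1983, Thm. (3.7); H. W. Lenstra 1992, §2.9). This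
file assembles the DECISION PROCEDURE on two integer coefficient lists (low degree first) from the
pieces proved in the sibling files and in the tree, and proves it correct:

  `nfIsoTest a b`: both lists must pass the LLL irreducibility test `irredTest` (tree,
  `IrreducibilityLLLDecide.lean`: monic and irreducible); then, on the trimmed lists `f, g` of
  degrees `n, m`: reject unless `n = m`; for `c = 0, 1, …, (n m)²` compute the norm polynomial
  `N_c = Res_Y(g(Y), f(X − cY))` (`normPoly`, exact integer interpolation of integer resultants,
  `NFIsoNormPoly.lean`) and look for the prime `ℓ` of LLL82 (3.6) for `N_c` (`goodPrime`, tree;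
  it exists iff `N_c` is squarefree over `ℚ`); at the first `c` where it exists, answer the LLL
  DEGREE TEST (`degTestWith`): factor `N_c mod ℓ` completely (`localFactorsCap`,
  `NFIsoLocalFactorsCap.lean`), Hensel-lift each local factor `u` of degree `≤ m` (`henselLift`, tree)
  to the precision `ℓ^k`, `ℓ^{2k} > degPrecision`, reduce the lattice `L_m(u)` (tree LLL machine,
  `firstRowSqNorm`) and accept iff some first vector is short, `|b₁|² ≤ testBound (m+1) |N_c|²`
  (`exists_irreducible_degree_le_iff`, `NFIsoDegreeTest.lean`).

* `separable_map_rat_of_separable_map_zmod` — for monic `N ∈ ℤ[X]`, separability modulo a prime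
  implies separability over `ℚ` (Gauss); `goodPrime_ne_none_of_separable` — conversely a
  squarefree `N` has a good prime in range (the tree's argument for irreducible input, verbatim
  from separability);
* `degTestWith_eq_true_iff` — the degree test decides "`N` has an irreducible factor over `ℚ` of
  degree `≤ j`";
* `monicList_trim_normPoly` — the norm polynomial is monic of degree `n m`;
* `multStep`, `nfIsoCore`, `nfIsoTest` and **`nfIsoTest_eq_true_iff`**:
  `nfIsoTest a b = true ↔` both `ofCoeffs a`, `ofCoeffs b` are monic irreducible and
  `ℚ[X]/(a) ≃ₐ[ℚ] ℚ[X]/(b)` (`NFIsomorphic`), by the tree's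
  `nfIsomorphic_iff_of_norm_values` / `exists_multiplier_norm_separable` (Trager–Landau–Cohen).

The polynomial running time (the `CodeFP` realisation) is the subject of the sequel files.

## References

* S. Landau, *Factoring polynomials over algebraic number fields*, SIAM J. Comput. 14 (1985)
  184–195: §1 (Thm. 1.4–1.5), §2 (Thm. 2.1 and the isomorphism corollary). [Landau1985]
* A. K. Lenstra, *Factoring polynomials over algebraic number fields*, EUROCAL '83, LNCS 162
  (1983) 245–254, Thm. (3.7). [Lenstra1983]
* H. Cohen, *A Course in Computational Algebraic Number Theory*, GTM 138, 1993, §3.6.2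
  (Alg. 3.6.4), Prop. 4.5.3, Alg. 4.5.4–4.5.6, §4.5.4. [Cohen1993]
* A. K. Lenstra, H. W. Lenstra Jr., L. Lovász, Math. Ann. 261 (1982), §3. [LenstraLenstraLovasz1982]
-/

open Polynomial

namespace Literature.NumberTheory.NumberFields

open Literature.Computability.Complexity Literature.Computability.Complexity.LLLFactoring
open Literature.Computability.Complexity.SumcheckMA Literature.Algebra.EuclideanLattices

/-! ### The test -/

/-- The exponent `k` of the modulus `ℓ^k` of the degree test: one more than the bit length of
`degPrecision`, so that `ℓ^k ≥ 2^{k-1} > degPrecision D j S` (LLL82 (3.3), any polynomially bounded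
`k` beyond the least one works). [cite: LenstraLenstraLovasz1982, (3.3)] -/
def degPrecisionExp (D j : ℕ) (S : ℤ) : ℕ := Nat.size (degPrecision D j S).toNat + 1

/-- **The degree test** for a monic trimmed `Nt` of degree `D` and a prime `ℓ` with `Nt mod ℓ`
squarefree: complete factorisation modulo `ℓ`, and for each local factor `u` of degree `≤ j` the
Hensel lift, the lattice `L_j(u)` and the length of its first reduced vector against the Mignotte
threshold. [cite: LenstraLenstraLovasz1982, (3.1)–(3.5) and Prop. (2.13)] [cite: Landau1985, §2] -/
noncomputable def degTestWith (Nt : List ℤ) (D j ℓ : ℕ) : Bool :=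
  (localFactorsCap ℓ (pnorm ℓ Nt)).any fun u =>
    decide (u.length - 1 ≤ j) &&
      decide (firstRowSqNorm (j + 1) (u.length - 1)
          (henselLift ℓ (degPrecisionExp D j (sqNormList Nt)) Nt u)
          (ℓ ^ degPrecisionExp D j (sqNormList Nt)) ≤
        testBound (j + 1) (sqNormList Nt))

/-- One multiplier `c`: the trimmed norm polynomial `N_c` of `(f, g)` (degrees `n`, `m`); `none` if
no prime of LLL82 (3.6) exists for it (`N_c` is not squarefree), otherwise the answer of the degree
test "does `N_c` have an irreducible factor of degree `≤ m`?". [cite: Cohen1993, Alg. 3.6.4 steps 1–4 and Alg. 4.5.4] [cite: Landau1985, §2 (Thm. 2.1)] -/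
noncomputable def multStep (f g : List ℤ) (m n c : ℕ) : Option Bool :=
  (goodPrime (trim (normPoly f g (c : ℤ) m n))).map fun ℓ =>
    degTestWith (trim (normPoly f g (c : ℤ) m n)) (n * m) m ℓ

/-- The core of the test on monic trimmed lists `f`, `g` (last entries `1`): equal lengths, then the
multiplier loop `c = 0, …, (n m)²`. [cite: Cohen1993, §4.5.4 and Alg. 4.5.5–4.5.6] [cite: Landau1985, §2] -/
noncomputable def nfIsoCore (f g : List ℤ) : Bool :=
  if f.length ≠ g.length then false
  else ((List.range (((f.length - 1) * (g.length - 1)) ^ 2 + 1)).findSome?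
    (multStep f g (g.length - 1) (f.length - 1))).getD false

/-- **The isomorphism test for number fields given by integer coefficient lists**: both must be
monic irreducible (`irredTest`), then `nfIsoCore` on the trimmed lists.
[cite: Landau1985, §2 (Cor.: isomorphism of algebraic number fields in polynomial time)] [cite: Lenstra1983, Thm. 3.7] [cite: Cohen1993, Alg. 4.5.6] -/
noncomputable def nfIsoTest (a b : List ℤ) : Bool :=
  irredTest a && irredTest b && nfIsoCore (trim a) (trim b)

/-! ### Separability over `ℚ` and modulo `ℓ` -/

/-- **A monic integer polynomial separable modulo a prime is separable over `ℚ`**: a repeated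
irreducible factor over `ℚ` is, by Gauss's lemma, the square of a monic integer factor, which stays
a repeated nonunit factor modulo `ℓ`. [cite: LenstraLenstraLovasz1982, proof of (3.6) (f mod p squarefree)] -/
theorem separable_map_rat_of_separable_map_zmod {ℓ : ℕ} [Fact ℓ.Prime] {N : ℤ[X]} (hN : N.Monic)
    (hsep : (N.map (Int.castRingHom (ZMod ℓ))).Separable) : (N.map (Int.castRingHom ℚ)).Separable := by
  set φ := Int.castRingHom (ZMod ℓ) with hφ
  rw [PerfectField.separable_iff_squarefree]
  by_contra hnsq
  have hN0 : N.map (Int.castRingHom ℚ) ≠ 0 := (hN.map _).ne_zero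
  have key := (squarefree_iff_irreducible_sq_not_dvd_of_ne_zero hN0).not.1 hnsq
  push Not at key
  obtain ⟨g, hg, hgg⟩ := key
  -- the monic integer factor under `g`
  obtain ⟨h, hhm, -, -, hhpos, hhg⟩ := exists_intPoly_of_irreducible_dvd_map hN hg (dvd_trans (dvd_mul_right g g) hgg)
  have hh2 : (h * h).map (Int.castRingHom ℚ) ∣ N.map (Int.castRingHom ℚ) := by
    rw [Polynomial.map_mul]
    exact (mul_dvd_mul hhg hhg).trans hgg
  have hdvd : h * h ∣ N := (Polynomial.map_dvd_map (Int.castRingHom ℚ) Int.cast_injective (hhm.mul hhm)).1 hh2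
  -- modulo `ℓ`
  have hsq : Squarefree (N.map φ) := hsep.squarefree
  have hbar : h.map φ * h.map φ ∣ N.map φ := by rw [← Polynomial.map_mul]; exact Polynomial.map_dvd φ hdvd
  have hunit := hsq _ hbar
  have hdeg : (h.map φ).natDegree = h.natDegree := hhm.natDegree_map φ
  have := natDegree_eq_zero_of_isUnit hunit
  omega

/-- **A squarefree monic integer polynomial has a good prime in range** (`goodPrime ≠ none`): the
tree's `goodPrime_ne_none_of_irreducible` uses irreducibility only through the separability of
`f` over `ℚ`; here is the same argument from separability. [cite: LenstraLenstraLovasz1982, proof of (3.6)] -/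
theorem goodPrime_ne_none_of_separable {f : List ℤ} {n : ℕ} (hf : MonicList f n)
    (hsepq : ((ofCoeffs f).map (Int.castRingHom ℚ)).Separable) : goodPrime f ≠ none := by
  obtain ⟨hmon, hdeg⟩ := hf.monic_ofCoeffs
  -- `R(f, f') ≠ 0`
  have hR : resultant (ofCoeffs f) (derivative (ofCoeffs f)) ≠ 0 := by
    set ψ := algebraMap ℤ ℚ with hψ
    have hψi : Function.Injective ψ := by rw [hψ]; exact Int.cast_injective
    have hsep : ((ofCoeffs f).map ψ).Separable := hsepq
    rw [separable_def, derivative_map] at hsep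
    have hne := resultant_ne_zero _ _ hsep
    rw [natDegree_map_eq_of_injective hψi, natDegree_map_eq_of_injective hψi, resultant_map_map] at hne
    exact fun h => hne (by rw [h, map_zero])
  obtain ⟨p, hprime, hple, hndvd⟩ := exists_prime_le_not_dvd_int hR
  haveI : Fact p.Prime := ⟨hprime⟩
  -- the prime is in range
  have hB0 : resBound f ≠ 0 := by
    have hS : 1 ≤ sqNormList f := by
      have := one_le_sqNorm_of_monic hmon; rw [← sqNormList_eq] at this; exact_mod_cast this
    have h1 : 0 < (f.length - 1) ^ (f.length - 1) := by
      rcases Nat.eq_zero_or_pos (f.length - 1) with h | h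
      · rw [h]; exact Nat.one_pos
      · exact Nat.pow_pos h
    exact Nat.pos_iff_ne_zero.1 (Nat.mul_pos h1 (Nat.pow_pos hS))
  have hrange : p ≤ primeRange f := by
    refine hple.trans ?_
    have hRle : (resultant (ofCoeffs f) (derivative (ofCoeffs f))).natAbs ≤ resBound f := by
      have h := natAbs_resultant_derivative_le hmon
      rw [← sqNormList_eq, Int.natAbs_natCast] at h
      rw [resBound, hf.1, Nat.add_sub_cancel, ← hdeg]
      exact h
    have hsz : Nat.size (resBound f) = Nat.log 2 (resBound f) + 1 :=
      le_antisymm (Nat.size_le.2 (Nat.lt_pow_succ_log_self one_lt_two _)) (Nat.lt_size.2 (Nat.pow_log_le_self 2 hB0))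
    have h1 : Nat.log 2 (resultant (ofCoeffs f) (derivative (ofCoeffs f))).natAbs + 1 ≤ Nat.size (resBound f) := by
      rw [hsz]; exact Nat.succ_le_succ (Nat.log_mono_right hRle)
    refine (smallPrimeBound_mono h1).trans ?_
    rw [primeRange]
    exact smallPrimeBound_le (by rw [hsz]; omega)
  -- and passes the test
  have hsep := separable_map_of_not_dvd_resultant hmon hndvd
  have htest : goodPrimeTest f p = true := by
    rw [goodPrimeTest, Bool.and_eq_true, isPrimeTD_iff, decide_eq_true_iff]
    refine ⟨hprime, (isCoprime_iff_pgcd_eq_one (p := p) _ _).1 ?_⟩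
    rw [(toZMod_pnorm_pderiv p f).1, (toZMod_pnorm_pderiv p f).2]
    exact (separable_def _).1 hsep
  intro hnone
  rw [goodPrime, List.find?_eq_none] at hnone
  exact absurd htest (by simpa using hnone p (List.mem_range.2 (by omega)))

/-! ### Correctness of the degree test -/

/-- The modulus is large enough: `degPrecision D j S < (ℓ^k)²` for `k = degPrecisionExp D j S`.
[cite: LenstraLenstraLovasz1982, (3.3)] -/
theorem degPrecision_lt_sq {ℓ : ℕ} (hℓ : ℓ.Prime) (D j : ℕ) (S : ℤ) :
    degPrecision D j S < ((ℓ ^ degPrecisionExp D j S : ℕ) : ℤ) ^ 2 := by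
  set k := degPrecisionExp D j S with hk
  have hp0 := hℓ.pos
  have h2k : (degPrecision D j S).toNat < 2 ^ (k - 1) := by
    rw [hk, degPrecisionExp, Nat.add_sub_cancel]; exact Nat.lt_size_self _
  have hpk : 2 ^ (k - 1) ≤ ℓ ^ k :=
    (Nat.pow_le_pow_left hℓ.two_le _).trans (Nat.pow_le_pow_right hp0 (Nat.sub_le _ _))
  have h1 : degPrecision D j S < ((ℓ ^ k : ℕ) : ℤ) := by
    have : ((degPrecision D j S).toNat : ℤ) < ((ℓ ^ k : ℕ) : ℤ) := by exact_mod_cast h2k.trans_le hpk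
    exact (Int.self_le_toNat _).trans_lt this
  have h2 : ((ℓ ^ k : ℕ) : ℤ) ≤ ((ℓ ^ k : ℕ) : ℤ) ^ 2 := by
    have : (1 : ℤ) ≤ (ℓ ^ k : ℕ) := by exact_mod_cast Nat.one_le_pow k ℓ hp0
    nlinarith
  exact h1.trans_le h2

/-- **The degree test is correct** (LLL82 Prop. (2.13) over all local factors): for `Nt` the list of
a monic integer polynomial `N` of degree `D ≥ 1`, `ℓ` a prime with `N mod ℓ` separable, and
`j ≥ 1`: `degTestWith Nt D j ℓ = true` iff `N` has an irreducible factor over `ℚ` of degree `≤ j`.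
[cite: LenstraLenstraLovasz1982, Prop. (2.13), (3.1)–(3.5)] [cite: Landau1985, §2] -/
theorem degTestWith_eq_true_iff {Nt : List ℤ} {D j ℓ : ℕ} (hNt : MonicList Nt D) (hD : 0 < D)
    (hℓ : ℓ.Prime) (hsep : ((ofCoeffs Nt).map (Int.castRingHom (ZMod ℓ))).Separable) :
    degTestWith Nt D j ℓ = true ↔
      ∃ g : ℚ[X], Irreducible g ∧ g ∣ (ofCoeffs Nt).map (Int.castRingHom ℚ) ∧ g.natDegree ≤ j := by
  haveI : Fact ℓ.Prime := ⟨hℓ⟩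
  have hp0 := hℓ.pos
  set N := ofCoeffs Nt with hN
  obtain ⟨hNm, hNd⟩ := hNt.monic_ofCoeffs
  rw [← hN] at hNm hNd
  set φ := Int.castRingHom (ZMod ℓ) with hφ
  have hsq : Squarefree (N.map φ) := hsep.squarefree
  have hSN : (sqNormList Nt : ℤ) = sqNorm N := by rw [sqNormList_eq]
  set k := degPrecisionExp D j (sqNormList Nt : ℤ) with hk
  have hk1 : 1 ≤ k := Nat.le_add_left 1 _
  have hK : degPrecision D j (sqNorm N) < ((ℓ ^ k : ℕ) : ℤ) ^ 2 := by
    rw [← hSN]; exact degPrecision_lt_sq hℓ D j _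
  -- `N mod ℓ`
  set fp := pnorm ℓ Nt with hfp
  have hfpZ : toZMod ℓ fp = N.map φ := by rw [hfp, toZMod_pnorm, toZMod, hN]
  have hfpn : Normal ℓ fp := normal_pnorm hp0 _
  have hfpm : (toZMod ℓ fp).Monic := by rw [hfpZ]; exact hNm.map φ
  have hfpd0 : (toZMod ℓ fp).natDegree = D := by rw [hfpZ, hNm.natDegree_map, hNd]
  have hfpne : fp ≠ [] := fun h => by have := hfpm.ne_zero; rw [h, toZMod_nil] at this; exact this rfl
  have hfplen : fp.length = D + 1 := by
    have := (hfpn.natDegree_toZMod hfpne).1; rw [hfpd0] at this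
    have := List.length_pos_of_ne_nil hfpne; omega
  have hfpd : (toZMod ℓ fp).natDegree = fp.length - 1 := by rw [hfpd0, hfplen]; rfl
  have hsqfp : Squarefree (toZMod ℓ fp) := by rw [hfpZ]; exact hsq
  obtain ⟨hfac, hprod, -⟩ := localFactorsCap_spec hfpn hfpm hfpd hsqfp
  have htoZ : toZMod ℓ Nt = N.map φ := by rw [toZMod, hN]
  -- every local factor: its Hensel lift
  have hlift : ∀ u ∈ localFactorsCap ℓ fp,
      MonicList (henselLift ℓ k Nt u) (u.length - 1) ∧
        toZMod ℓ (henselLift ℓ k Nt u) = toZMod ℓ u ∧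
        ModDvd (ℓ ^ k) (ofCoeffs (henselLift ℓ k Nt u)) N := by
    intro u hu
    obtain ⟨hun, hum, hud, huirr, hu2, -⟩ := hfac u hu
    have hune : u ≠ [] := by rintro rfl; simp at hu2
    have hudvd : toZMod ℓ u ∣ N.map φ := by
      rw [← hfpZ, ← hprod]; exact List.dvd_prod (List.mem_map.2 ⟨u, hu, rfl⟩)
    have hdvdf : toZMod ℓ u ∣ toZMod ℓ Nt := by rw [htoZ]; exact hudvd
    have hcof : toZMod ℓ (henselCofactor ℓ Nt u) = N.map φ /ₘ toZMod ℓ u := by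
      rw [henselCofactor, toZMod_pnorm, (toZMod_pdivmod hp0 hune hum hud).1, htoZ]
    have hcop : IsCoprime (toZMod ℓ u) (toZMod ℓ (henselCofactor ℓ Nt u)) := by
      rw [hcof]; exact isCoprime_cofactor hsq huirr hum hudvd
    obtain ⟨hUml, -, hUp, hUmod⟩ := henselLift_spec hk1 hun hum hud hdvdf hcop
    rw [hN]
    exact ⟨hUml, hUp, hUmod⟩
  -- the criterion over the list of lifts
  set U : List ℤ[X] := (localFactorsCap ℓ fp).map fun u => ofCoeffs (henselLift ℓ k Nt u) with hU
  have hUspec : ∀ P ∈ U, P.Monic ∧ Irreducible (P.map φ) ∧ ModDvd (ℓ ^ k) P N := by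
    intro P hP
    obtain ⟨u, hu, rfl⟩ := List.mem_map.1 hP
    obtain ⟨hUml, hUp, hUmod⟩ := hlift u hu
    obtain ⟨-, -, -, huirr, -, -⟩ := hfac u hu
    refine ⟨hUml.monic_ofCoeffs.1, ?_, hUmod⟩
    have : (ofCoeffs (henselLift ℓ k Nt u)).map φ = toZMod ℓ u := hUp
    rw [this]; exact huirr
  have hcomplete : ∀ ρ : (ZMod ℓ)[X], Irreducible ρ → ρ ∣ N.map φ → ∃ P ∈ U, P.map φ ∣ ρ := by
    intro ρ hρ hρN
    rw [← hfpZ] at hρN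
    obtain ⟨u, hu, huρ⟩ := exists_mem_localFactorsCap_dvd hfpn hfpm hfpd hsqfp hρ hρN
    refine ⟨ofCoeffs (henselLift ℓ k Nt u), List.mem_map.2 ⟨u, hu, rfl⟩, ?_⟩
    have : (ofCoeffs (henselLift ℓ k Nt u)).map φ = toZMod ℓ u := (hlift u hu).2.1
    rw [this]; exact huρ
  have hcrit := exists_irreducible_degree_le_iff (j := j) hℓ hk1 hNm hNd hD hsq U hUspec hcomplete hK
  rw [hcrit]
  -- read the program
  rw [degTestWith, List.any_eq_true]
  constructor
  · rintro ⟨u, hu, hb⟩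
    rw [Bool.and_eq_true, decide_eq_true_iff, decide_eq_true_iff] at hb
    obtain ⟨hdj, hle⟩ := hb
    obtain ⟨hUml, -, -⟩ := hlift u hu
    obtain ⟨hUm, hUd⟩ := hUml.monic_ofCoeffs
    set d := u.length - 1 with hd
    have hI : (factorInstance (j + 1) d (ofCoeffs (henselLift ℓ k Nt u)) (ℓ ^ k)).IsNonsingular :=
      isNonsingular_factorInstance hUm hUd (by omega) (pow_ne_zero _ hℓ.ne_zero)
    refine ⟨ofCoeffs (henselLift ℓ k Nt u), List.mem_map.2 ⟨u, hu, rfl⟩, by rw [hUd]; exact hdj, ?_⟩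
    rw [hUd]
    rw [firstRowSqNorm_eq hI (Nat.succ_pos j), hSN] at hle
    exact hle
  · rintro ⟨P, hP, hPj, hb⟩
    obtain ⟨u, hu, rfl⟩ := List.mem_map.1 hP
    obtain ⟨hUml, -, -⟩ := hlift u hu
    obtain ⟨hUm, hUd⟩ := hUml.monic_ofCoeffs
    set d := u.length - 1 with hd
    rw [hUd] at hPj hb
    have hI : (factorInstance (j + 1) d (ofCoeffs (henselLift ℓ k Nt u)) (ℓ ^ k)).IsNonsingular :=
      isNonsingular_factorInstance hUm hUd (by omega) (pow_ne_zero _ hℓ.ne_zero)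
    refine ⟨u, hu, ?_⟩
    rw [Bool.and_eq_true, decide_eq_true_iff, decide_eq_true_iff]
    refine ⟨hPj, ?_⟩
    rw [firstRowSqNorm_eq hI (Nat.succ_pos j), hSN]
    exact hb

/-! ### The norm polynomial of the test -/

section Norm

variable {f g : List ℤ} {n m : ℕ}

/-- A polynomial which, over a field `E` splitting the monic `p`, `q`, is the product of the
`deg p · deg q` monic linear factors `X − (a + c b)` is monic of degree `deg p · deg q`. [folklore] -/
theorem monic_of_map_eq_prod_pairSums {E : Type*} [Field E] [CharZero E] {p q : ℤ[X]} (hp : p.Monic)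
    (hq : q.Monic) (hps : (p.map (algebraMap ℤ E)).Splits) (hqs : (q.map (algebraMap ℤ E)).Splits) (c : ℤ)
    {N : ℤ[X]} (hN : N.map (algebraMap ℤ E) =
      (((p.aroots E) ×ˢ (q.aroots E)).map fun ij => X - C (ij.1 + (c : ℚ) • ij.2)).prod) :
    N.Monic ∧ N.natDegree = p.natDegree * q.natDegree := by
  have hinj : Function.Injective (algebraMap ℤ E) := (algebraMap ℤ E).injective_int
  have hmonE : ((((p.aroots E) ×ˢ (q.aroots E)).map fun ij : E × E => (X - C (ij.1 + (c : ℚ) • ij.2) : E[X])).prod).Monic :=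
    monic_multiset_prod_of_monic _ _ fun ij _ => monic_X_sub_C _
  rw [← hN] at hmonE
  have hNm : N.Monic := (Function.Injective.monic_map_iff hinj).2 hmonE
  have hcard : Multiset.card ((p.aroots E) ×ˢ (q.aroots E)) = p.natDegree * q.natDegree := by
    rw [Multiset.card_product, aroots_def, aroots_def, ← hps.natDegree_eq_card_roots,
      ← hqs.natDegree_eq_card_roots, hp.natDegree_map, hq.natDegree_map]
  have hdegE : ((((p.aroots E) ×ˢ (q.aroots E)).map fun ij : E × E => (X - C (ij.1 + (c : ℚ) • ij.2) : E[X])).prod).natDegree =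
      p.natDegree * q.natDegree := by
    rw [natDegree_multiset_prod_of_monic _ (fun F hF => by
      obtain ⟨ij, -, rfl⟩ := Multiset.mem_map.1 hF
      exact monic_X_sub_C _), Multiset.map_map]
    have : ∀ x ∈ ((p.aroots E) ×ˢ (q.aroots E)).map (natDegree ∘ fun ij : E × E => X - C (ij.1 + (c : ℚ) • ij.2)), x = 1 := by
      intro x hx
      obtain ⟨ij, -, rfl⟩ := Multiset.mem_map.1 hx
      exact natDegree_X_sub_C _
    rw [Multiset.eq_replicate_card.2 this, Multiset.card_map, Multiset.sum_replicate, smul_eq_mul, mul_one, hcard]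
  rw [← hN, natDegree_map_eq_of_injective hinj] at hdegE
  exact ⟨hNm, hdegE⟩

/-- **The norm polynomial is monic of degree `n m`** (it is `∏_{p(a)=0, q(b)=0} (X − (a + c b))` over
an algebraic closure), so its trimmed list is a monic list of degree `n m` with the same polynomial.
[cite: Cohen1993, §3.6.2 (Lemma 3.6.1–3.6.2)] [cite: Landau1985, §1 (Thm. 1.4)] -/
theorem monicList_trim_normPoly (hf : MonicList f n) (hg : MonicList g m) (c : ℤ) :
    MonicList (trim (normPoly f g c m n)) (n * m) ∧
      ofCoeffs (trim (normPoly f g c m n)) = ofCoeffs (normPoly f g c m n) ∧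
      (ofCoeffs (normPoly f g c m n)).Monic ∧ (ofCoeffs (normPoly f g c m n)).natDegree = n * m := by
  obtain ⟨hpm, hpd⟩ := hf.monic_ofCoeffs
  obtain ⟨hqm, hqd⟩ := hg.monic_ofCoeffs
  set p := ofCoeffs f with hp
  set q := ofCoeffs g with hq
  set N := ofCoeffs (normPoly f g c m n) with hN
  obtain ⟨hNdeg, hNeval⟩ := normPoly_spec (pl := f) (ql := g) hqd hpd c
  rw [← hN] at hNdeg hNeval
  -- over an algebraic closure `N` is a product of `n m` monic linear factors
  let E := AlgebraicClosure ℚ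
  have hps : (p.map (algebraMap ℤ E)).Splits := IsAlgClosed.splits _
  have hqs : (q.map (algebraMap ℤ E)).Splits := IsAlgClosed.splits _
  have hNdeg' : N.natDegree ≤ p.natDegree * q.natDegree := by rw [hpd, hqd]; exact hNdeg
  have hNeval' : ∀ x₀ : ℕ, x₀ ≤ p.natDegree * q.natDegree →
      N.eval (x₀ : ℤ) = resultant q (p.comp (C (x₀ : ℤ) - C c * X)) q.natDegree p.natDegree := by
    intro x₀ hx₀
    rw [hpd, hqd] at hx₀ ⊢
    exact hNeval x₀ hx₀
  have hprodE := map_eq_prod_pairSums_of_eval_eq_resultant hpm hqm hps hqs c hNdeg' hNeval'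
  obtain ⟨hNm, hNd⟩ := monic_of_map_eq_prod_pairSums hpm hqm hps hqs c hprodE
  rw [hpd, hqd] at hNd
  -- the trimmed list
  set Nt := trim (normPoly f g c m n) with hNt
  have hNtN : ofCoeffs Nt = N := by rw [hNt, ofCoeffs_trim]
  have hlast : Nt.getLast? = some 1 := (monic_iff_getLast?_trim _).1 hNm
  have hne : Nt ≠ [] := fun h => by rw [h] at hlast; simp at hlast
  obtain ⟨hdegt, -⟩ := natDegree_ofCoeffs_trim (l := normPoly f g c m n) hne
  rw [← hNt, hNtN, hNd] at hdegt
  have hlen : Nt.length = n * m + 1 := by have := List.length_pos_of_ne_nil hne; omega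
  exact ⟨⟨hlen, hlast⟩, hNtN, hNm, hNd⟩

/-- **One multiplier, soundness**: if `multStep f g m n c = some r` then `N_c` is separable over `ℚ`
and `r` answers "does `N_c` have an irreducible factor over `ℚ` of degree `≤ m`?".
[cite: Landau1985, §2 (Thm. 2.1)] [cite: Cohen1993, Alg. 3.6.4 and Alg. 4.5.4] -/
theorem multStep_eq_some (hf : MonicList f n) (hg : MonicList g m) (hn : 0 < n) (hm : 0 < m)
    {c : ℕ} {r : Bool} (h : multStep f g m n c = some r) :
    ((ofCoeffs (normPoly f g (c : ℤ) m n)).map (Int.castRingHom ℚ)).Separable ∧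
      (r = true ↔ ∃ g' : ℚ[X], Irreducible g' ∧
        g' ∣ (ofCoeffs (normPoly f g (c : ℤ) m n)).map (Int.castRingHom ℚ) ∧ g'.natDegree ≤ m) := by
  obtain ⟨hNt, hNtN, hNm, hNd⟩ := monicList_trim_normPoly hf hg (c : ℤ)
  rw [multStep, Option.map_eq_some_iff] at h
  obtain ⟨ℓ, hgp, rfl⟩ := h
  obtain ⟨hprime, -, hsepℓ⟩ := goodPrime_some hgp
  haveI : Fact ℓ.Prime := ⟨hprime⟩
  rw [hNtN] at hsepℓ
  refine ⟨separable_map_rat_of_separable_map_zmod hNm hsepℓ, ?_⟩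
  have := degTestWith_eq_true_iff (j := m) hNt (Nat.mul_pos hn hm) hprime (by rw [hNtN]; exact hsepℓ)
  rw [hNtN] at this
  exact this

/-- **One multiplier, completeness**: if `N_c` is separable over `ℚ` then `multStep f g m n c ≠ none`.
[cite: LenstraLenstraLovasz1982, proof of (3.6)] [cite: Cohen1993, Alg. 3.6.4 step 1] -/
theorem multStep_ne_none (hf : MonicList f n) (hg : MonicList g m) {c : ℕ}
    (hsep : ((ofCoeffs (normPoly f g (c : ℤ) m n)).map (Int.castRingHom ℚ)).Separable) :
    multStep f g m n c ≠ none := by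
  obtain ⟨hNt, hNtN, -, -⟩ := monicList_trim_normPoly hf hg (c : ℤ)
  rw [multStep, Ne, Option.map_eq_none_iff]
  exact goodPrime_ne_none_of_separable hNt (by rw [hNtN]; exact hsep)

/-- **Correctness of the core** on monic trimmed lists of irreducible polynomials of positive degree:
`nfIsoCore f g = true ↔ ℚ[X]/(f) ≃ₐ[ℚ] ℚ[X]/(g)`. (Equal degrees are necessary; some `c ≤ (n m)²`
gives a squarefree norm, `exists_multiplier_norm_separable`, so the loop stops at a squarefree `N_c`,
where `nfIsomorphic_iff_of_norm_values` and the degree test decide.)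
[cite: Landau1985, §2 (Thm. 2.1 and Cor.)] [cite: Cohen1993, Prop. 4.5.3, Alg. 4.5.4, §3.6.2] [cite: Lenstra1983, Thm. 3.7] -/
theorem nfIsoCore_eq_true_iff (hf : MonicList f n) (hg : MonicList g m) (hn : 0 < n) (hm : 0 < m)
    (hfi : Irreducible (ofCoeffs f)) (hgi : Irreducible (ofCoeffs g)) :
    nfIsoCore f g = true ↔ NFIsomorphic (ofCoeffs f) (ofCoeffs g) := by
  obtain ⟨hpm, hpd⟩ := hf.monic_ofCoeffs
  obtain ⟨hqm, hqd⟩ := hg.monic_ofCoeffs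
  set p := ofCoeffs f with hp
  set q := ofCoeffs g with hq
  have hflen : f.length = n + 1 := hf.1
  have hglen : g.length = m + 1 := hg.1
  rw [nfIsoCore, hflen, hglen, Nat.add_sub_cancel, Nat.add_sub_cancel]
  by_cases hnm : n + 1 ≠ m + 1
  · rw [if_pos hnm]
    simp only [Bool.false_eq_true, false_iff]
    intro hiso
    have := hiso.natDegree_eq hpm hqm
    rw [hpd, hqd] at this
    omega
  rw [if_neg hnm]
  have hnm' : n = m := by omega
  -- a good multiplier exists in range
  obtain ⟨c₀, hc₀, hgood⟩ := exists_multiplier_norm_separable hpm hfi hqm hgi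
  rw [hpd, hqd] at hc₀
  have hsep₀ : ((ofCoeffs (normPoly f g (c₀ : ℤ) m n)).map (Int.castRingHom ℚ)).Separable := by
    obtain ⟨hNdeg, hNeval⟩ := normPoly_spec (pl := f) (ql := g) hqd hpd (c₀ : ℤ)
    refine hgood _ (by rw [hpd, hqd]; exact hNdeg) fun x₀ hx₀ => ?_
    rw [hpd, hqd] at hx₀ ⊢
    exact hNeval x₀ hx₀
  have hne₀ := multStep_ne_none hf hg hsep₀
  -- so the search returns some answer, at some `c₁`
  set L := List.range ((n * m) ^ 2 + 1) with hL
  have hsome : (L.findSome? (multStep f g m n)).isSome = true := by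
    rw [List.findSome?_isSome_iff]
    refine ⟨c₀, List.mem_range.2 (by omega), ?_⟩
    exact Option.isSome_iff_ne_none.2 hne₀
  obtain ⟨r, hr⟩ := Option.isSome_iff_exists.1 hsome
  rw [hr, Option.getD_some]
  obtain ⟨c₁, -, hc₁⟩ := List.exists_of_findSome?_eq_some hr
  obtain ⟨hsep₁, hriff⟩ := multStep_eq_some hf hg hn hm hc₁
  rw [hriff]
  obtain ⟨hNdeg, hNeval⟩ := normPoly_spec (pl := f) (ql := g) hqd hpd (c₁ : ℤ)
  have key := nfIsomorphic_iff_of_norm_values hpm hfi hqm hgi (c₁ : ℤ) (N := ofCoeffs (normPoly f g (c₁ : ℤ) m n))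
    (by rw [hpd, hqd]; exact hNdeg) (fun x₀ hx₀ => by rw [hpd, hqd] at hx₀ ⊢; exact hNeval x₀ hx₀) hsep₁
  rw [key, hpd, hqd]
  exact ⟨fun h => ⟨hnm', h⟩, fun h => h.2⟩

end Norm

/-! ### Correctness of the test -/

/-- A monic irreducible integer polynomial has positive degree. [folklore] -/
theorem natDegree_pos_of_monic_irreducible {F : ℤ[X]} (hF : F.Monic) (hirr : Irreducible F) : 0 < F.natDegree := by
  by_contra h0
  have : F = 1 := eq_one_of_monic_natDegree_zero hF (by omega)
  exact hirr.not_isUnit (this ▸ isUnit_one)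

/-- **Correctness of the isomorphism test** (Landau 1985, Cor. to Thm. 2.1; A. K. Lenstra 1983,
Thm. (3.7); H. W. Lenstra 1992, §2.9): for all integer coefficient lists `a`, `b`,
`nfIsoTest a b = true` iff `ofCoeffs a` and `ofCoeffs b` are monic irreducible and the number fields
`ℚ[X]/(a)`, `ℚ[X]/(b)` are isomorphic. [cite: Landau1985, §2 (Cor.: isomorphism in polynomial time)] [cite: Lenstra1983, Thm. 3.7] [cite: Cohen1993, §4.5.4] -/
theorem nfIsoTest_eq_true_iff (a b : List ℤ) :
    nfIsoTest a b = true ↔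
      ((ofCoeffs a).Monic ∧ Irreducible (ofCoeffs a)) ∧ ((ofCoeffs b).Monic ∧ Irreducible (ofCoeffs b)) ∧
        NFIsomorphic (ofCoeffs a) (ofCoeffs b) := by
  rw [nfIsoTest, Bool.and_eq_true, Bool.and_eq_true, irredTest_eq_true_iff, irredTest_eq_true_iff]
  constructor
  · rintro ⟨⟨ha, hb⟩, hcore⟩
    refine ⟨ha, hb, ?_⟩
    obtain ⟨ham, hai⟩ := ha
    obtain ⟨hbm, hbi⟩ := hb
    have hfa : ofCoeffs (trim a) = ofCoeffs a := ofCoeffs_trim a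
    have hfb : ofCoeffs (trim b) = ofCoeffs b := ofCoeffs_trim b
    have hla : (trim a).getLast? = some 1 := (monic_iff_getLast?_trim a).1 ham
    have hlb : (trim b).getLast? = some 1 := (monic_iff_getLast?_trim b).1 hbm
    have hnea : trim a ≠ [] := fun h => by rw [h] at hla; simp at hla
    have hneb : trim b ≠ [] := fun h => by rw [h] at hlb; simp at hlb
    have hMa : MonicList (trim a) ((trim a).length - 1) := ⟨by have := List.length_pos_of_ne_nil hnea; omega, hla⟩
    have hMb : MonicList (trim b) ((trim b).length - 1) := ⟨by have := List.length_pos_of_ne_nil hneb; omega, hlb⟩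
    have hna : 0 < (trim a).length - 1 := by
      rw [← hMa.monic_ofCoeffs.2, hfa]; exact natDegree_pos_of_monic_irreducible ham hai
    have hnb : 0 < (trim b).length - 1 := by
      rw [← hMb.monic_ofCoeffs.2, hfb]; exact natDegree_pos_of_monic_irreducible hbm hbi
    have := (nfIsoCore_eq_true_iff hMa hMb hna hnb (hfa ▸ hai) (hfb ▸ hbi)).1 hcore
    rwa [hfa, hfb] at this
  · rintro ⟨ha, hb, hiso⟩
    refine ⟨⟨ha, hb⟩, ?_⟩
    obtain ⟨ham, hai⟩ := ha
    obtain ⟨hbm, hbi⟩ := hb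
    have hfa : ofCoeffs (trim a) = ofCoeffs a := ofCoeffs_trim a
    have hfb : ofCoeffs (trim b) = ofCoeffs b := ofCoeffs_trim b
    have hla : (trim a).getLast? = some 1 := (monic_iff_getLast?_trim a).1 ham
    have hlb : (trim b).getLast? = some 1 := (monic_iff_getLast?_trim b).1 hbm
    have hnea : trim a ≠ [] := fun h => by rw [h] at hla; simp at hla
    have hneb : trim b ≠ [] := fun h => by rw [h] at hlb; simp at hlb
    have hMa : MonicList (trim a) ((trim a).length - 1) := ⟨by have := List.length_pos_of_ne_nil hnea; omega, hla⟩
    have hMb : MonicList (trim b) ((trim b).length - 1) := ⟨by have := List.length_pos_of_ne_nil hneb; omega, hlb⟩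
    have hna : 0 < (trim a).length - 1 := by
      rw [← hMa.monic_ofCoeffs.2, hfa]; exact natDegree_pos_of_monic_irreducible ham hai
    have hnb : 0 < (trim b).length - 1 := by
      rw [← hMb.monic_ofCoeffs.2, hfb]; exact natDegree_pos_of_monic_irreducible hbm hbi
    refine (nfIsoCore_eq_true_iff hMa hMb hna hnb (hfa ▸ hai) (hfb ▸ hbi)).2 ?_
    rwa [hfa, hfb]

end Literature.NumberTheory.NumberFields
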